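import Summits.PneNP.PneNP.Theorems.NegLimitedAmplifiedWindowBaseDefs
import Literature.Computability.Complexity.Rossman2008CliqueProofs
import Mathlib
import HarnessLib

/-!
# Amplified critical window — base helpers (a): the size-bias identity and the ladder balance
(cell pnp-ideate, rung F-N1/p3, ROUND-11; line `amplified-window` on item stmt-PneNP-19860, stub B
`CriticalWindowHardness`; typed statements `SizeBiasIdentity`, `LadderBalance` of
`Theorems/NegLimitedAmplifiedWindowBaseDefs.lean` = pnp-ideate-p3 r11/base-helpers.lean)

* `sizeBiasIdentity_holds : SizeBiasIdentity` — for every real `p`, every `k` and every real graph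
  functional `F`: `p^{C(k,2)} · Σ_{|A|=k} E_{G(n,p)}[F(G ∪ K_A)] = E_{G(n,p)}[N_k(G)·F(G)]`.  Proof: the
  tree's planting identity `sum_filter_forall_gnpWeight_mul` (`Σ_{x ⊇ t} w_p(x) G(x) =
  p^{e(t)} Σ_x w_p(x) G(x ∪ t)`, a polynomial identity valid for all real `p`) with `t = K_A`,
  `e(K_A) = C(k,2)` (`card_filter_cliqueVec`), summed over `A` and re-indexed (`N_k(x) = #{A : K_A ⊆ x}`).
* `ladderBalance_holds : LadderBalance` — the sprinkling ladder `p_i(p₀) = 1 − (1−p₀)(1−s)^i`, `i < T`, has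
  mean clique probability `≤ T/2` at `p₀ = 0` (hypothesis) and `≥ T/2` at `p₀ = 1` (the complete graph
  has a `k`-clique for `k ≤ n`), and each `gnpProb` is a polynomial in `p₀`; the intermediate value
  theorem gives an exactly balancing `p₀ ∈ [0,1]`.

HONEST FRAMING: two elementary probability facts (an identity and an IVT application); inputs to the
OPEN stub B; no hardness is proved; FRONTIER rung F-N1 — nothing here bears on P vs NP.
-/

set_option linter.dupNamespace false -- `Summit.PneNP.PneNP.…`: summit = sub-problem name (D-0017 single-conjunct layout)

namespace Summit.PneNP.PneNP.Theorems.NegLimitedDoor.AmplifiedWindowBase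

open Finset
open Literature.Computability.Complexity

/-! ### The size-bias identity -/

/-- `e(K_A) = C(|A|,2)`. -/
theorem edgeCount_cliqueVec {n : ℕ} (A : Finset (Fin n)) : edgeCount (cliqueVec A) = (#A).choose 2 := by
  rw [edgeCount, card_filter_cliqueVec]

/-- `N_k(x)` as a sum of indicators over the `k`-sets. -/
theorem cliqueCount_eq_sum {n k : ℕ} (x : (⊤ : SimpleGraph (Fin n)).edgeSet → Bool) :
    (cliqueCount n k x : ℝ) =
      ∑ A ∈ powersetCard k (univ : Finset (Fin n)),
        (if (∀ e, cliqueVec A e = true → x e = true) then (1 : ℝ) else 0) := by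
  classical
  rw [cliqueCount, sum_boole]

/-- **`SizeBiasIdentity` holds**: `p^{C(k,2)} · Σ_{|A|=k} E[F(G ∪ K_A)] = E[N_k(G)·F(G)]` for all real
`p` (planting identity `sum_filter_forall_gnpWeight_mul` summed over the `k`-sets). -/
theorem sizeBiasIdentity_holds : SizeBiasIdentity := by
  classical
  intro n k p F
  -- each planted term is a restricted expectation
  have hA : ∀ A ∈ powersetCard k (univ : Finset (Fin n)),
      p ^ k.choose 2 * ∑ x, gnpWeight n p x * F (x ⊔ cliqueVec A) =
        ∑ x, gnpWeight n p x * ((if (∀ e, cliqueVec A e = true → x e = true) then (1 : ℝ) else 0) * F x) := by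
    intro A hA
    have hcard : #A = k := (mem_powersetCard.1 hA).2
    have h := sum_filter_forall_gnpWeight_mul p (cliqueVec A) F
    rw [edgeCount_cliqueVec, hcard] at h
    rw [← h, sum_filter]
    refine sum_congr rfl fun x _ => ?_
    split_ifs <;> ring
  rw [mul_sum, sum_congr rfl hA, sum_comm]
  refine sum_congr rfl fun x _ => ?_
  rw [cliqueCount_eq_sum, sum_mul, mul_sum]

/-! ### The ladder balance -/

/-- `gnpWeight n p x` is continuous in `p` (a polynomial). -/
theorem continuous_gnpWeight {n : ℕ} (x : (⊤ : SimpleGraph (Fin n)).edgeSet → Bool) :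
    Continuous fun p : ℝ => gnpWeight n p x := by
  unfold gnpWeight
  exact (continuous_id.pow _).mul ((continuous_const.sub continuous_id).pow _)

/-- `gnpProb n p S` is continuous in `p`. -/
theorem continuous_gnpProb {n : ℕ} (S : Finset ((⊤ : SimpleGraph (Fin n)).edgeSet → Bool)) :
    Continuous fun p : ℝ => gnpProb n p S := by
  unfold gnpProb
  exact continuous_finsetSum S fun x _ => continuous_gnpWeight x

/-- At `p = 1` the complete graph carries all the mass: `gnpWeight n 1 (fun _ => true) = 1`. -/
theorem gnpWeight_one_top {n : ℕ} :
    gnpWeight n 1 (fun _ : (⊤ : SimpleGraph (Fin n)).edgeSet => true) = 1 := by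
  have hE : edgeCount (fun _ : (⊤ : SimpleGraph (Fin n)).edgeSet => true) = n.choose 2 := by
    rw [edgeCount, filter_true_of_mem fun e _ => rfl, card_univ, card_edgeSet_top_fin]
  rw [gnpWeight, hE, Nat.sub_self, pow_zero, one_pow, one_mul]

/-- The complete graph has a `k`-clique for `k ≤ n`: `1 ≤ N_k(K_n)`. -/
theorem one_le_cliqueCount_top {n k : ℕ} (hkn : k ≤ n) :
    1 ≤ cliqueCount n k (fun _ : (⊤ : SimpleGraph (Fin n)).edgeSet => true) := by
  classical
  unfold cliqueCount
  rw [filter_true_of_mem fun A _ => fun e _ => rfl, card_powersetCard, card_univ, Fintype.card_fin]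
  exact Nat.succ_le_of_lt (Nat.choose_pos hkn)

/-- At `p = 1` a `k`-clique is present with probability `≥ 1` (in fact `= 1`) when `k ≤ n`. -/
theorem one_le_gnpProb_one_clique {n k : ℕ} (hkn : k ≤ n) :
    1 ≤ gnpProb n 1 (univ.filter fun x => 1 ≤ cliqueCount n k x) := by
  classical
  unfold gnpProb
  have hmem : (fun _ : (⊤ : SimpleGraph (Fin n)).edgeSet => true) ∈
      univ.filter (fun x => 1 ≤ cliqueCount n k x) := by
    rw [mem_filter]
    exact ⟨mem_univ _, one_le_cliqueCount_top hkn⟩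
  calc (1 : ℝ) = gnpWeight n 1 (fun _ : (⊤ : SimpleGraph (Fin n)).edgeSet => true) := gnpWeight_one_top.symm
    _ ≤ ∑ x ∈ univ.filter (fun x => 1 ≤ cliqueCount n k x), gnpWeight n 1 x :=
        single_le_sum (fun x _ => gnpWeight_nonneg zero_le_one le_rfl x) hmem

/-- **`LadderBalance` holds**: by the intermediate value theorem some start density `p₀ ∈ [0,1]` makes
the sprinkling ladder's mean clique probability exactly `T/2`. -/
theorem ladderBalance_holds : LadderBalance := by
  classical
  intro n k T s hkn hT hs0 hs1 hlow
  set S := univ.filter (fun x : (⊤ : SimpleGraph (Fin n)).edgeSet → Bool => 1 ≤ cliqueCount n k x)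
    with hS
  set f : ℝ → ℝ := fun p₀ => ∑ i ∈ range T, gnpProb n (1 - (1 - p₀) * (1 - s) ^ i) S with hf
  have hcont : Continuous f := by
    refine continuous_finsetSum _ fun i _ => ?_
    exact (continuous_gnpProb S).comp
      (continuous_const.sub ((continuous_const.sub continuous_id).mul continuous_const))
  have hf0 : f 0 ≤ T / 2 := by
    have : f 0 = ∑ i ∈ range T, gnpProb n (1 - (1 - s) ^ i) S := by
      simp only [hf, sub_zero, one_mul]
    rw [this]
    exact hlow
  have hf1 : (T : ℝ) / 2 ≤ f 1 := by
    have : f 1 = ∑ i ∈ range T, gnpProb n 1 S := by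
      simp only [hf, sub_self, zero_mul, sub_zero]
    rw [this, sum_const, card_range, nsmul_eq_mul]
    have h1 := one_le_gnpProb_one_clique hkn
    have hT' : (0 : ℝ) ≤ T := Nat.cast_nonneg T
    nlinarith
  obtain ⟨p₀, hp₀, hfp₀⟩ :=
    intermediate_value_Icc (zero_le_one' ℝ) hcont.continuousOn ⟨hf0, hf1⟩
  exact ⟨p₀, hp₀.1, hp₀.2, hfp₀⟩

end Summit.PneNP.PneNP.Theorems.NegLimitedDoor.AmplifiedWindowBase
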